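import Literature.MathematicalPhysics.QuantumLattice.FermionOperatorsProofs
import Mathlib.Analysis.Normed.Algebra.Exponential
import Mathlib.Analysis.Normed.Algebra.MatrixExponential
import Mathlib.Analysis.Matrix.Normed
import Mathlib.Topology.Algebra.Module.FiniteDimension
import HarnessLib

/-!
# Second quantisation of an order embedding: Jordan–Wigner matrices in a larger volume

For finite linearly ordered orbital sets `ι ↪o ι'` (an order embedding `e`), the Fock space
over `ι'` is `ℓ²(𝒫 ι') ≅ ℓ²(𝒫 ι) ⊗ ℓ²(𝒫 (ι' ∖ e ι))`, but because the image `e ι` is in general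
INTERLEAVED with its complement, the Jordan–Wigner matrices `c_{e i}` on the big Fock space are
not the naive Kronecker products `c_i ⊗ 1`: moving `c_{e i}` past the occupied environment
orbitals below `e i` costs the sign `(-1)^{#{j ∈ r : j < e i}}` (`envSign`). This file constructs
the resulting unital `*`-algebra homomorphism (Bratteli–Robinson II, §5.2.2: the CAR algebra is
functorial in the one-particle space, `𝔄(𝔥₁) ⊆ 𝔄(𝔥₂)` for `𝔥₁ ⊆ 𝔥₂`, realised here concretely in
the Jordan–Wigner = Fock representation of Thm. 5.2.5 / eq. (5.2.13))

* `jwEmbed e : Matrix (𝒫 ι) (𝒫 ι) ℂ →ₐ[ℂ] Matrix (𝒫 ι') (𝒫 ι') ℂ`,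
  `(jwEmbed e a)_{u',v'} = [env u' = env v'] · a_{pre u', pre v'} · ∏_{i ∈ pre u' Δ pre v'} envSign (env u') i`
  (`pre u'` = the part of `u'` inside the image, pulled back to `ι`; `env u'` = the part outside),

and PROVES: it is a unital algebra homomorphism (`jwEmbed`), it is a `*`-map
(`jwEmbed_conjTranspose`), it sends `c_i ↦ c_{e i}` and `c†_i ↦ c†_{e i}`
(`jwEmbed_annihilation`, `jwEmbed_creation`), it multiplies traces by the dimension of the
environment, `Tr (jwEmbed e a) = 2^{|ι'| - |ι|} Tr a` (`trace_jwEmbed`: the normalised trace is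
preserved — the product-state property of the tracial state, Bratteli–Robinson II §5.2.2), and
it commutes with the matrix exponential (`jwEmbed_exp`). Consequently every polynomial
expression in creation/annihilation operators of the orbitals `i ∈ ι` has the same normalised
trace, and the same normalised trace of its exponential, whether computed on the Fock space of
`ι` or on that of any larger `ι'` — the volume-independence of local Gibbs factors used in
polymer expansions of lattice fermion systems (Ueltschi 1999, §2.3: the weight `ρ(𝒜)` of a
polymer only involves the sites of `𝒜`).

## Mathlib / tree search

Tree: `annihilation`, `creation`, `jwSign` (`HubbardWave0`), entries `annihilation_apply`,
`creation_apply`, `jwSign_mul_self` (`FermionOperatorsProofs`); the CAR subalgebras of a FIXED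
Fock space (`FermionTraceFactorization.carSubalgebra`). No change-of-volume map
(`lean search 'jwEmbed|secondQuant|Fock.*embed'`: nothing). Mathlib: `OrderEmbedding`,
`Finset.preimage`, `NormedSpace.map_exp`, `LinearMap.continuous_of_finiteDimensional`.

## References

* O. Bratteli, D. W. Robinson, *Operator Algebras and Quantum Statistical Mechanics II*,
  2nd ed. (Springer 1997), §5.2.2, Thm. 5.2.5 and eq. (5.2.13) (Jordan–Wigner / Fock
  representation; isotony of the local CAR algebras; the trace state is a product state).
  [BratteliRobinsonII1997]
* D. Ueltschi, J. Stat. Phys. 95 (1999) 693, §2.3 (polymer weights are local). [Ueltschi1999]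
-/

noncomputable section

namespace Literature.MathematicalPhysics.QuantumLattice

open Matrix Finset
open scoped symmDiff

namespace JWEmbed

/-! ### The image part of a configuration and the environment signs (no finiteness needed) -/

section Pre

variable {ι ι' : Type*} [LinearOrder ι] [LinearOrder ι'] {e : ι ↪o ι'}

/-- The image part of a configuration `u' ⊆ ι'`, pulled back to `ι`: `{i : e i ∈ u'}`. [folklore] -/
def pre (e : ι ↪o ι') (u' : Finset ι') : Finset ι := u'.preimage e e.injective.injOn

/-- Membership in the image part. [folklore] -/
@[simp] theorem mem_pre {u' : Finset ι'} {i : ι} : i ∈ pre e u' ↔ e i ∈ u' := by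
  simp [pre]

/-- Adding an image orbital changes the image part accordingly. [folklore] -/
theorem pre_insert (i : ι) (u' : Finset ι') : pre e (insert (e i) u') = insert i (pre e u') := by
  ext i'
  simp only [mem_pre, Finset.mem_insert]
  rw [e.injective.eq_iff]

/-- Recombining an image part and an environment. [folklore] -/
def combine (e : ι ↪o ι') (u : Finset ι) (r : Finset ι') : Finset ι' := u.map e.toEmbedding ∪ r

/-- Membership in a recombined configuration. [folklore] -/
@[simp] theorem mem_combine {u : Finset ι} {r : Finset ι'} {j : ι'} :
    j ∈ combine e u r ↔ (∃ i ∈ u, e i = j) ∨ j ∈ r := by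
  simp [combine]

/-- The sign picked up by `c_{e i}` from the environment orbitals `r` below `e i`:
`(-1)^{#{j ∈ r : j < e i}}`. [cite: BratteliRobinsonII1997, §5.2.2 (Jordan–Wigner transformation)] -/
def envSign (e : ι ↪o ι') (r : Finset ι') (i : ι) : ℂ := (-1) ^ (r.filter (· < e i)).card

/-- The product of the environment signs over a finite set of image orbitals. [folklore] -/
def transSign (e : ι ↪o ι') (r : Finset ι') (X : Finset ι) : ℂ := ∏ i ∈ X, envSign e r i

/-- The environment sign squares to one. [folklore] -/
theorem envSign_mul_self (r : Finset ι') (i : ι) : envSign e r i * envSign e r i = 1 := by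
  rw [envSign, ← pow_add, ← two_mul, pow_mul]
  norm_num

/-- The environment sign is real. [folklore] -/
theorem star_envSign (r : Finset ι') (i : ι) : star (envSign e r i) = envSign e r i := by
  simp [envSign]

/-- The empty product of environment signs. [folklore] -/
@[simp] theorem transSign_empty (r : Finset ι') : transSign e r ∅ = 1 := by
  simp [transSign]

/-- The product of environment signs over a singleton. [folklore] -/
@[simp] theorem transSign_singleton (r : Finset ι') (i : ι) : transSign e r {i} = envSign e r i := by
  simp [transSign]

/-- Products of environment signs are real. [folklore] -/
theorem star_transSign (r : Finset ι') (X : Finset ι) : star (transSign e r X) = transSign e r X := by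
  unfold transSign
  rw [star_prod]
  exact Finset.prod_congr rfl fun i _ => star_envSign r i

/-- **Sign algebra**: the environment signs are `±1`, so their products over two sets multiply
to the product over the symmetric difference. [folklore] -/
theorem transSign_mul_transSign (r : Finset ι') (X Y : Finset ι) :
    transSign e r X * transSign e r Y = transSign e r (X ∆ Y) := by
  unfold transSign
  have hX : ∏ i ∈ X, envSign e r i = ∏ i ∈ X ∪ Y, if i ∈ X then envSign e r i else 1 := by
    rw [← Finset.prod_filter, Finset.filter_mem_eq_inter, Finset.union_inter_cancel_left]
  have hY : ∏ i ∈ Y, envSign e r i = ∏ i ∈ X ∪ Y, if i ∈ Y then envSign e r i else 1 := by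
    rw [← Finset.prod_filter, Finset.filter_mem_eq_inter, Finset.union_inter_cancel_right]
  have hXY : ∏ i ∈ X ∆ Y, envSign e r i = ∏ i ∈ X ∪ Y, if i ∈ X ∆ Y then envSign e r i else 1 := by
    rw [← Finset.prod_filter, Finset.filter_mem_eq_inter]
    congr 1
    exact (Finset.inter_eq_right.2 symmDiff_le_sup).symm
  rw [hX, hY, hXY, ← Finset.prod_mul_distrib]
  refine Finset.prod_congr rfl fun i _ => ?_
  by_cases hiX : i ∈ X <;> by_cases hiY : i ∈ Y <;>
    simp [hiX, hiY, Finset.mem_symmDiff, envSign_mul_self]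

end Pre

/-! ### Splitting a configuration of the big volume into image part and environment -/

section Env

variable {ι ι' : Type*} [LinearOrder ι] [LinearOrder ι'] [Fintype ι] {e : ι ↪o ι'}

/-- The image orbitals `e ι ⊆ ι'` as a finset. [folklore] -/
def rangeF (e : ι ↪o ι') : Finset ι' := Finset.univ.map e.toEmbedding

/-- The environment part of a configuration: its orbitals outside the image of `e`. [folklore] -/
def env (e : ι ↪o ι') (u' : Finset ι') : Finset ι' := u' \ rangeF e

/-- Membership in the image finset. [folklore] -/
@[simp] theorem mem_rangeF {j : ι'} : j ∈ rangeF e ↔ ∃ i, e i = j := by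
  simp [rangeF]

/-- Image orbitals lie in the image finset. [folklore] -/
theorem apply_mem_rangeF (i : ι) : e i ∈ rangeF e := mem_rangeF.2 ⟨i, rfl⟩

/-- Membership in the environment part. [folklore] -/
@[simp] theorem mem_env {u' : Finset ι'} {j : ι'} : j ∈ env e u' ↔ j ∈ u' ∧ j ∉ rangeF e := by
  simp [env]

/-- The environment is disjoint from the image. [folklore] -/
theorem disjoint_env_rangeF (u' : Finset ι') : Disjoint (env e u') (rangeF e) :=
  Finset.sdiff_disjoint

/-- A configuration is recovered from its two parts. [folklore] -/
theorem combine_pre_env (u' : Finset ι') : combine e (pre e u') (env e u') = u' := by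
  ext j
  rw [mem_combine]
  constructor
  · rintro (⟨i, hi, rfl⟩ | hj)
    · exact mem_pre.1 hi
    · exact (mem_env.1 hj).1
  · intro hj
    by_cases hr : j ∈ rangeF e
    · obtain ⟨i, rfl⟩ := mem_rangeF.1 hr
      exact Or.inl ⟨i, mem_pre.2 hj, rfl⟩
    · exact Or.inr (mem_env.2 ⟨hj, hr⟩)

/-- The image part of a recombined configuration. [folklore] -/
theorem pre_combine {r : Finset ι'} (hr : Disjoint r (rangeF e)) (u : Finset ι) :
    pre e (combine e u r) = u := by
  ext i
  rw [mem_pre, mem_combine]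
  constructor
  · rintro (⟨i', hi', h⟩ | h)
    · rwa [← e.injective h]
    · exact absurd (apply_mem_rangeF i) (Finset.disjoint_left.1 hr h)
  · intro hi
    exact Or.inl ⟨i, hi, rfl⟩

/-- The environment part of a recombined configuration. [folklore] -/
theorem env_combine {r : Finset ι'} (hr : Disjoint r (rangeF e)) (u : Finset ι) :
    env e (combine e u r) = r := by
  ext j
  rw [mem_env, mem_combine]
  constructor
  · rintro ⟨⟨i, -, rfl⟩ | h, hj⟩
    · exact absurd (apply_mem_rangeF i) hj
    · exact h
  · intro hj
    exact ⟨Or.inr hj, Finset.disjoint_left.1 hr hj⟩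

/-- Two configurations agree iff both parts agree. [folklore] -/
theorem eq_iff_pre_eq_and_env_eq {u' v' : Finset ι'} :
    u' = v' ↔ pre e u' = pre e v' ∧ env e u' = env e v' := by
  constructor
  · rintro rfl; exact ⟨rfl, rfl⟩
  · rintro ⟨h1, h2⟩
    rw [← combine_pre_env (e := e) u', h1, h2, combine_pre_env]

/-- Adding an image orbital does not change the environment. [folklore] -/
theorem env_insert (i : ι) (u' : Finset ι') : env e (insert (e i) u') = env e u' := by
  ext j
  simp only [mem_env, Finset.mem_insert]
  constructor
  · rintro ⟨rfl | hj, hjr⟩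
    · exact absurd (apply_mem_rangeF i) hjr
    · exact ⟨hj, hjr⟩
  · rintro ⟨hj, hjr⟩
    exact ⟨Or.inr hj, hjr⟩

/-- The characterisation of `insert (e i) u'` by its two parts. [folklore] -/
theorem eq_insert_apply_iff {i : ι} {u' v' : Finset ι'} :
    v' = insert (e i) u' ↔ pre e v' = insert i (pre e u') ∧ env e v' = env e u' := by
  rw [eq_iff_pre_eq_and_env_eq (e := e), pre_insert, env_insert]

/-- **The Jordan–Wigner sign in the big volume factorises** into the sign of the image part and
the environment sign. [cite: BratteliRobinsonII1997, §5.2.2 (Jordan–Wigner transformation)] -/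
theorem jwSign_apply_eq (i : ι) (u' : Finset ι') :
    jwSign (e i) u' = jwSign i (pre e u') * envSign e (env e u') i := by
  have hsplit : u'.filter (fun j => j < e i) =
      ((pre e u').filter (fun i' => i' < i)).map e.toEmbedding ∪ (env e u').filter (fun j => j < e i) := by
    conv_lhs => rw [← combine_pre_env (e := e) u']
    rw [combine, Finset.filter_union, Finset.filter_map]
    congr 2
    ext i'
    simp
  have hdisj : Disjoint (((pre e u').filter (fun i' => i' < i)).map e.toEmbedding)
      ((env e u').filter (fun j => j < e i)) := by
    rw [Finset.disjoint_left]
    intro j hj hj'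
    obtain ⟨i', -, rfl⟩ := Finset.mem_map.1 hj
    exact (mem_env.1 (Finset.mem_filter.1 hj').1).2 (apply_mem_rangeF i')
  rw [jwSign, jwSign, envSign, hsplit, Finset.card_union_of_disjoint hdisj, Finset.card_map, pow_add]

/-! ### The matrix of the embedding -/

/-- The matrix of `jwEmbed e a` (see the module docstring). [cite: BratteliRobinsonII1997, §5.2.2, Thm. 5.2.5] -/
def embedFun (e : ι ↪o ι') (a : Matrix (Finset ι) (Finset ι) ℂ) : Matrix (Finset ι') (Finset ι') ℂ :=
  fun u' v' => if env e u' = env e v' then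
    a (pre e u') (pre e v') * transSign e (env e u') (pre e u' ∆ pre e v') else 0

/-- The entries of the embedded matrix (definitional). [folklore] -/
theorem embedFun_apply (a : Matrix (Finset ι) (Finset ι) ℂ) (u' v' : Finset ι') :
    embedFun e a u' v' = if env e u' = env e v' then
      a (pre e u') (pre e v') * transSign e (env e u') (pre e u' ∆ pre e v') else 0 := rfl

/-- The embedding is unital. [cite: BratteliRobinsonII1997, §5.2.2, Thm. 5.2.5] -/
theorem embedFun_one : embedFun e (1 : Matrix (Finset ι) (Finset ι) ℂ) = 1 := by
  ext u' v'
  rw [embedFun_apply]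
  by_cases h : u' = v'
  · subst h
    rw [if_pos rfl, symmDiff_self, Finset.bot_eq_empty, transSign_empty, mul_one, Matrix.one_apply_eq,
      Matrix.one_apply_eq]
  · rw [Matrix.one_apply_ne h]
    by_cases henv : env e u' = env e v'
    · have hpre : pre e u' ≠ pre e v' := fun h' => h (eq_iff_pre_eq_and_env_eq.2 ⟨h', henv⟩)
      rw [if_pos henv, Matrix.one_apply_ne hpre, zero_mul]
    · rw [if_neg henv]

/-- The embedding is additive. [folklore] -/
theorem embedFun_add (a b : Matrix (Finset ι) (Finset ι) ℂ) :
    embedFun e (a + b) = embedFun e a + embedFun e b := by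
  ext u' v'
  simp only [embedFun_apply, Matrix.add_apply]
  split_ifs <;> ring

/-- The embedding is homogeneous. [folklore] -/
theorem embedFun_smul (c : ℂ) (a : Matrix (Finset ι) (Finset ι) ℂ) :
    embedFun e (c • a) = c • embedFun e a := by
  ext u' v'
  simp only [embedFun_apply, Matrix.smul_apply, smul_eq_mul]
  split_ifs <;> ring

/-- The embedding maps zero to zero. [folklore] -/
theorem embedFun_zero : embedFun e (0 : Matrix (Finset ι) (Finset ι) ℂ) = 0 := by
  ext u' v'
  simp [embedFun_apply]

/-- **The embedding is a `*`-map.** [cite: BratteliRobinsonII1997, §5.2.2, Thm. 5.2.5] -/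
theorem embedFun_conjTranspose (a : Matrix (Finset ι) (Finset ι) ℂ) :
    embedFun e aᴴ = (embedFun e a)ᴴ := by
  ext u' v'
  rw [conjTranspose_apply, embedFun_apply, embedFun_apply, conjTranspose_apply]
  by_cases h : env e u' = env e v'
  · rw [if_pos h, if_pos h.symm, star_mul', star_transSign, h, symmDiff_comm]
  · rw [if_neg h, if_neg (fun h' => h h'.symm), star_zero]

/-- **`c_i ↦ c_{e i}`.** [cite: BratteliRobinsonII1997, §5.2.2, eq. (5.2.13) (Jordan–Wigner form of the annihilation operators)] -/
theorem embedFun_annihilation (i : ι) : embedFun e (annihilation i) = annihilation (e i) := by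
  ext u' v'
  rw [embedFun_apply, annihilation_apply, annihilation_apply]
  by_cases h : e i ∉ u' ∧ v' = insert (e i) u'
  · obtain ⟨hiu, hv⟩ := h
    have hiu' : i ∉ pre e u' := fun h' => hiu (mem_pre.1 h')
    obtain ⟨hpre, henv⟩ := eq_insert_apply_iff.1 hv
    have hsd : pre e u' ∆ pre e v' = {i} := by
      rw [hpre]
      ext j
      simp only [Finset.mem_symmDiff, Finset.mem_insert, Finset.mem_singleton]
      constructor
      · rintro (⟨hj, hj'⟩ | ⟨rfl | hj, hj'⟩)
        · exact absurd (Or.inr hj) hj'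
        · rfl
        · exact absurd hj hj'
      · rintro rfl
        exact Or.inr ⟨Or.inl rfl, hiu'⟩
    have hc1 : e i ∉ u' ∧ v' = insert (e i) u' := ⟨hiu, hv⟩
    have hc2 : i ∉ pre e u' ∧ pre e v' = insert i (pre e u') := ⟨hiu', hpre⟩
    rw [if_pos henv.symm, if_pos hc2, if_pos hc1, hsd, transSign_singleton, jwSign_apply_eq]
  · rw [if_neg h]
    by_cases henv : env e u' = env e v'
    · rw [if_pos henv]
      by_cases hc2 : i ∉ pre e u' ∧ pre e v' = insert i (pre e u')
      · exfalso
        apply h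
        exact ⟨fun h' => hc2.1 (mem_pre.2 h'), eq_insert_apply_iff.2 ⟨hc2.2, henv.symm⟩⟩
      · rw [if_neg hc2, zero_mul]
    · rw [if_neg henv]

/-- **`c†_i ↦ c†_{e i}`.** [cite: BratteliRobinsonII1997, §5.2.2, eq. (5.2.13)] -/
theorem embedFun_creation (i : ι) : embedFun e (creation i) = creation (e i) := by
  rw [creation, embedFun_conjTranspose, embedFun_annihilation, creation]

end Env

/-! ### Sums over the big configuration space, multiplicativity, trace -/

section Fin

variable {ι ι' : Type*} [LinearOrder ι] [LinearOrder ι'] [Fintype ι] [Fintype ι'] {e : ι ↪o ι'}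

/-- Summing over the configurations with a prescribed environment `r` is summing over the
image parts. [folklore] -/
theorem sum_filter_env_eq {M : Type*} [AddCommMonoid M] {r : Finset ι'} (hr : Disjoint r (rangeF e))
    (g : Finset ι' → M) :
    ∑ w' ∈ (Finset.univ : Finset (Finset ι')).filter (fun w' => env e w' = r), g w' =
      ∑ w : Finset ι, g (combine e w r) := by
  refine Finset.sum_nbij' (pre e) (fun w => combine e w r) ?_ ?_ ?_ ?_ ?_
  · intro w' _; exact Finset.mem_univ _
  · intro w _
    exact Finset.mem_filter.2 ⟨Finset.mem_univ _, env_combine hr w⟩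
  · intro w' hw'
    have h := (Finset.mem_filter.1 hw').2
    rw [← h, combine_pre_env]
  · intro w _
    exact pre_combine hr w
  · intro w' hw'
    have h := (Finset.mem_filter.1 hw').2
    conv_lhs => rw [← combine_pre_env (e := e) w', h]

/-- Summing a function of the image part over all configurations of the big volume counts each
image part `2^{|ι'| - |ι|}` times (once per environment). [folklore] -/
theorem sum_comp_pre_eq {M : Type*} [AddCommMonoid M] (g : Finset ι → M) :
    ∑ u' : Finset ι', g (pre e u') = 2 ^ (Fintype.card ι' - Fintype.card ι) • ∑ u : Finset ι, g u := by
  have hmaps : ∀ u' ∈ (Finset.univ : Finset (Finset ι')), env e u' ∈ ((rangeF e)ᶜ).powerset := by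
    intro u' _
    rw [Finset.mem_powerset]
    intro j hj
    exact Finset.mem_compl.2 (mem_env.1 hj).2
  rw [← Finset.sum_fiberwise_of_maps_to hmaps]
  have hinner : ∀ r ∈ ((rangeF e)ᶜ).powerset,
      ∑ u' ∈ (Finset.univ : Finset (Finset ι')).filter (fun u' => env e u' = r), g (pre e u') =
        ∑ u : Finset ι, g u := by
    intro r hr
    have hr' : Disjoint r (rangeF e) := by
      rw [Finset.mem_powerset] at hr
      exact Finset.disjoint_left.2 fun j hj h => Finset.mem_compl.1 (hr hj) h
    rw [sum_filter_env_eq hr']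
    exact Finset.sum_congr rfl fun w _ => by rw [pre_combine hr']
  rw [Finset.sum_congr rfl hinner, Finset.sum_const, Finset.card_powerset, Finset.card_compl,
    rangeF, Finset.card_map, Finset.card_univ]

/-- **Multiplicativity** (the sign algebra `transSign_mul_transSign` and
`(X Δ W) Δ (W Δ Y) = X Δ Y`). [cite: BratteliRobinsonII1997, §5.2.2, Thm. 5.2.5] -/
theorem embedFun_mul (a b : Matrix (Finset ι) (Finset ι) ℂ) :
    embedFun e (a * b) = embedFun e a * embedFun e b := by
  ext u' v'
  set r := env e u' with hr
  have hrd : Disjoint r (rangeF e) := disjoint_env_rangeF u'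
  rw [Matrix.mul_apply]
  -- only the middle configurations with environment `r` contribute
  have hvanish : ∀ w' ∈ (Finset.univ : Finset (Finset ι')),
      embedFun e a u' w' * embedFun e b w' v' ≠ 0 → env e w' = r := by
    intro w' _ hne
    by_contra hw'
    apply hne
    rw [embedFun_apply, if_neg (fun h => hw' h.symm), zero_mul]
  rw [← Finset.sum_filter_of_ne hvanish, sum_filter_env_eq hrd]
  -- the summand at `combine w r`
  have hterm : ∀ w : Finset ι, embedFun e a u' (combine e w r) * embedFun e b (combine e w r) v' =
      if r = env e v' then a (pre e u') w * b w (pre e v') *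
        (transSign e r (pre e u' ∆ w) * transSign e r (w ∆ pre e v')) else 0 := by
    intro w
    rw [embedFun_apply, embedFun_apply, env_combine hrd, pre_combine hrd, ← hr, if_pos rfl]
    split_ifs <;> ring
  rw [Finset.sum_congr rfl fun w _ => hterm w, embedFun_apply, ← hr]
  by_cases hrv : r = env e v'
  · simp only [if_pos hrv]
    rw [Matrix.mul_apply, Finset.sum_mul]
    refine Finset.sum_congr rfl fun w _ => ?_
    rw [transSign_mul_transSign, symmDiff_assoc, symmDiff_symmDiff_cancel_left]
  · simp only [if_neg hrv, Finset.sum_const_zero]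

/-- **The trace scales by the dimension of the environment**: `Tr (embed a) = 2^{|ι'|-|ι|} Tr a`.
[cite: BratteliRobinsonII1997, §5.2.2 (the trace state is a product state)] -/
theorem trace_embedFun (a : Matrix (Finset ι) (Finset ι) ℂ) :
    (embedFun e a).trace = 2 ^ (Fintype.card ι' - Fintype.card ι) * a.trace := by
  have hdiag : ∀ u' : Finset ι', embedFun e a u' u' = a (pre e u') (pre e u') := by
    intro u'
    rw [embedFun_apply, if_pos rfl, symmDiff_self, Finset.bot_eq_empty, transSign_empty, mul_one]
  simp only [Matrix.trace, Matrix.diag_apply, hdiag]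
  rw [sum_comp_pre_eq (e := e) (fun u => a u u), nsmul_eq_mul, Nat.cast_pow, Nat.cast_ofNat]

end Fin

end JWEmbed

open JWEmbed

section Main

variable {ι ι' : Type*} [LinearOrder ι] [LinearOrder ι'] [Fintype ι] [Fintype ι']

/-- **Second quantisation of the order embedding `e : ι ↪o ι'`** as a unital algebra
homomorphism of the Fock-space matrix algebras (the Jordan–Wigner-twisted inclusion
`𝔄(ι) ↪ 𝔄(ι')`). [cite: BratteliRobinsonII1997, §5.2.2, Thm. 5.2.5 (isotony 𝔄(𝔥₁) ⊆ 𝔄(𝔥₂) in the Fock representation)] -/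
def jwEmbed (e : ι ↪o ι') : Matrix (Finset ι) (Finset ι) ℂ →ₐ[ℂ] Matrix (Finset ι') (Finset ι') ℂ where
  toFun := embedFun e
  map_one' := embedFun_one
  map_mul' := embedFun_mul
  map_zero' := embedFun_zero
  map_add' := embedFun_add
  commutes' c := by
    rw [Algebra.algebraMap_eq_smul_one, Algebra.algebraMap_eq_smul_one, embedFun_smul, embedFun_one]

variable (e : ι ↪o ι')

/-- `jwEmbed` unfolded to its matrix. [folklore] -/
theorem jwEmbed_apply (a : Matrix (Finset ι) (Finset ι) ℂ) : jwEmbed e a = embedFun e a := rfl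

/-- `jwEmbed` is a `*`-map. [cite: BratteliRobinsonII1997, §5.2.2, Thm. 5.2.5] -/
theorem jwEmbed_conjTranspose (a : Matrix (Finset ι) (Finset ι) ℂ) :
    jwEmbed e aᴴ = (jwEmbed e a)ᴴ :=
  embedFun_conjTranspose a

/-- `jwEmbed e c_i = c_{e i}`. [cite: BratteliRobinsonII1997, §5.2.2, eq. (5.2.13)] -/
@[simp] theorem jwEmbed_annihilation (i : ι) : jwEmbed e (annihilation i) = annihilation (e i) :=
  embedFun_annihilation i

/-- `jwEmbed e c†_i = c†_{e i}`. [cite: BratteliRobinsonII1997, §5.2.2, eq. (5.2.13)] -/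
@[simp] theorem jwEmbed_creation (i : ι) : jwEmbed e (creation i) = creation (e i) :=
  embedFun_creation i

/-- **Normalised traces are preserved**: `Tr (jwEmbed e a) = 2^{|ι'| - |ι|} · Tr a`.
[cite: BratteliRobinsonII1997, §5.2.2 (the trace state is a product state)] -/
theorem trace_jwEmbed (a : Matrix (Finset ι) (Finset ι) ℂ) :
    (jwEmbed e a).trace = 2 ^ (Fintype.card ι' - Fintype.card ι) * a.trace :=
  trace_embedFun a

/-- `jwEmbed` is continuous (a linear map of finite-dimensional spaces). [folklore] -/
theorem continuous_jwEmbed : Continuous (jwEmbed e) :=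
  (jwEmbed e).toLinearMap.continuous_of_finiteDimensional

/-- **`jwEmbed` commutes with the matrix exponential** (`NormedSpace.map_exp` for the continuous
ring homomorphism `jwEmbed e`, in the sup operator norm; the exponential does not depend on the
norm). [folklore] -/
theorem jwEmbed_exp (X : Matrix (Finset ι) (Finset ι) ℂ) :
    jwEmbed e (NormedSpace.exp X) = NormedSpace.exp (jwEmbed e X) :=
  open scoped Matrix.Norms.Operator in NormedSpace.map_exp (jwEmbed e) (continuous_jwEmbed e) X

/-- The normalised trace of the exponential of a second-quantised operator is volume independent:
`Tr e^{jwEmbed X} = 2^{|ι'|-|ι|} Tr e^{X}`. [cite: Ueltschi1999, §2.3 (locality of the polymer weights)] -/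
theorem trace_exp_jwEmbed (X : Matrix (Finset ι) (Finset ι) ℂ) :
    (NormedSpace.exp (jwEmbed e X)).trace =
      2 ^ (Fintype.card ι' - Fintype.card ι) * (NormedSpace.exp X).trace := by
  rw [← jwEmbed_exp, trace_jwEmbed]

end Main

end Literature.MathematicalPhysics.QuantumLattice

end
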